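import Summits.BirchSwinnertonDyer.BirchSwinnertonDyer.Theorems.ByReductionTypeAtTwoGoodOrdTowerControlAllP
import Summits.BirchSwinnertonDyer.BirchSwinnertonDyer.Theorems.ByReductionTypeAtTwoSelmerTowerModel
import Literature.NumberTheory.EllipticCurves.GlobalMinimalModelProofs
import HarnessLib

/-!
# Route `ByReductionTypeAtTwo`, item `OrdKatoHalfAtTwo` (stmt-BirchSwinnertonDyer-19271), TOWER road: MAZUR'S CONTROL THEOREM
# for EVERY Weierstrass curve over `ℚ` at EVERY prime — no hypothesis (part 2 of 2; part 1 = `…SelmerTowerModel.lean`)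

HONEST FRAMING (cell `bsd-2adic`, run/shared/lean/pub/bsd-2adic/, seat `bsd-2adic-tower-1` GEN 21, HUMAN RULINGS
D-0036 / D-0054 / D-0074): theorems only (no definition, no named fact, no `sorry`, axioms the standard trio); closes no
route item by itself; nothing booked; BSD is not proved by any of this. Follow-on (β) of `…GoodOrdTowerControl{,P,AllP}.lean`.

WHAT IT PROVES. The named predicates `WeierstrassCurve.selmer_control κ` (Mazur's control theorem, Greenberg LNM 1716
Thm. 1.2) and `WeierstrassCurve.Greenberg1999_kerG_bounded κ` (Lemma 3.5) are statements about ONE Weierstrass model `W`;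
part 1 showed that every group they mention is matched, along the substitution isomorphisms
`H¹(H, W[p^∞]) ≃ H¹(H, (C • W)[p^∞])`, with the corresponding group of `C • W`, and that their hypotheses (good reduction
and the unit-root condition at `v ∣ p`) are model-independent. Hence:

* `selmer_control_smul_iff`, `Greenberg1999_kerG_bounded_smul_iff` — the predicates are EQUIVALENT for `W` and `C • W`
  (any number field `K : Type`, any prime, any `ℤ_p`-extension).
* `GoodOrdTower.selmer_control (W : WeierstrassCurve ℚ) (κ : ZpExtension ℚ p) : W.selmer_control κ` — **MAZUR'S CONTROL
  THEOREM over `ℚ` for EVERY Weierstrass curve, EVERY prime, EVERY `κ`, with NO hypothesis**: an elliptic `W` has a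
  globally minimal model `C • W` (`hasGlobalMinimalModel_rat_holds`, tree theorem), for which the control chain is proved
  at every prime (`selmer_control_all`, p624991); a singular `W` satisfies the predicate vacuously.
* `GoodOrdTower.Greenberg1999_kerG_bounded` (Lemma 3.5, same generality), `GoodOrdTower.isTorsion_of_finite_selmerGroup`
  (Thm. 1.4 through the chain), and the binder shapes
  `∀ (W : WeierstrassCurve ℚ) {p} [Fact p.Prime] (κ : ZpExtension ℚ p), W.selmer_control κ` /
  `… W.Greenberg1999_kerG_bounded κ` of the Literature reductions (`Greenberg1999_coinvariantsRank_eq_selmerCorank_rat_of_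
  selmer_control`, `…_of_kerG_bounded`), inhabited (`selmer_control_forall`, `Greenberg1999_kerG_bounded_forall`).

References: Mazur, Invent. Math. 18 (1972) §6; Greenberg, LNM 1716 (1999) Thm 1.2, Thm 1.4, §3 Lemma 3.5; Silverman,
*AEC* VIII.8.3 (global minimal models over `ℚ`), X.§4.
-/

set_option autoImplicit false
-- the Theorems namespace of this sub repeats the summit name by design (D-0017 nested layout: Summit.<S>.<Sub>)
set_option linter.dupNamespace false

noncomputable section

open scoped Classical

namespace Summit.BirchSwinnertonDyer.BirchSwinnertonDyer.Theorems.GoodOrdTower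

open NumberField IsDedekindDomain Field Literature.NumberTheory.EllipticCurves
  Literature.NumberTheory.EllipticCurves.IsogenySelmerInfty WeierstrassCurve

/-! ## §5. `selmer_control` and `Greenberg1999_kerG_bounded` along `C • W` (any number field) -/

section SmulIff

variable {K : Type} [Field K] [NumberField K] (W : WeierstrassCurve K) {p : ℕ} [Fact p.Prime]
  (κ : ZpExtension K p) (C : VariableChange K)

/-- **Mazur's control theorem is a statement about `E/K`, not about a model**: `(C • W).selmer_control κ` implies
`W.selmer_control κ` (kernels and cokernels of `Sel_{p^∞}(E/K_n) → Sel_{p^∞}(E/K_∞)^{Γ_n}` for `W` and `C • W` are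
isomorphic, §§1–3; the hypotheses agree, §4). [cite: GreenbergLNM1716, Thm 1.2] [cite: SilvermanAEC2009, X.§4] -/
theorem selmer_control_of_smul (h : (C • W).selmer_control κ) : W.selmer_control κ := by
  intro _ hκ hp
  obtain ⟨B, hB⟩ := h hκ fun v hv ↦ (hasGoodReductionAt_and_hasUnitRootAt_smul_iff v W C).mpr (hp v hv)
  refine ⟨B, fun n ↦ ?_⟩
  obtain ⟨hfin₁, hcard₁, hfin₂, hcard₂⟩ := hB n
  obtain ⟨eₙ, heₙ⟩ := exists_h1EquivOfSmul W p C (κ.layerSubgroup n)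
  obtain ⟨e, he⟩ := exists_h1EquivOfSmul W p C κ.kerSubgroup
  have hker : ∀ x, eₙ x ∈ ((C • W).layerToInfty κ n).ker ⊓ (C • W).selmerLayer κ n ↔
      x ∈ (W.layerToInfty κ n).ker ⊓ W.selmerLayer κ n :=
    fun x ↦ by rw [AddSubgroup.mem_inf, AddSubgroup.mem_inf, heₙ, h1Map_smul_mem_ker_layerToInfty_iff,
      h1Map_smul_mem_selmerLayer_iff]
  have hA' : ∀ y, e y ∈ ((C • W).selmerLayer κ n).map ((C • W).layerToInfty κ n) ↔
      y ∈ (W.selmerLayer κ n).map (W.layerToInfty κ n) :=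
    fun y ↦ by rw [he, h1Map_smul_mem_map_selmerLayer_iff]
  have hB' : ∀ y, e y ∈ (C • W).selmerInfty κ ⊓ (C • W).layerInvariants κ n ↔
      y ∈ W.selmerInfty κ ⊓ W.layerInvariants κ n :=
    fun y ↦ by rw [AddSubgroup.mem_inf, AddSubgroup.mem_inf, he, h1Map_smul_mem_selmerInfty_iff,
      h1Map_smul_mem_layerInvariants_iff]
  obtain ⟨hf₁, hc₁⟩ := finite_iff_and_natCard_eq_of_iff eₙ hker
  obtain ⟨hf₂, hc₂⟩ := finite_iff_and_natCard_quotient_eq_of_iff e hA' hB'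
  exact ⟨hf₁.mp hfin₁, hc₁ ▸ hcard₁, hf₂.mp hfin₂, hc₂ ▸ hcard₂⟩

omit [NumberField K] [Fact p.Prime] in
/-- `W.IsElliptic` from `(C • W).IsElliptic` (`W = C⁻¹ • (C • W)`). [folklore] -/
theorem isElliptic_of_smul [h : (C • W).IsElliptic] : W.IsElliptic := by
  rw [← inv_smul_smul C W]; infer_instance

/-- **`(C • W).selmer_control κ ↔ W.selmer_control κ`.** [cite: GreenbergLNM1716, Thm 1.2] [cite: SilvermanAEC2009, X.§4] -/
theorem selmer_control_smul_iff : (C • W).selmer_control κ ↔ W.selmer_control κ := by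
  refine ⟨selmer_control_of_smul W κ C, fun h ↦ selmer_control_of_smul (C • W) κ C⁻¹ ?_⟩
  rwa [inv_smul_smul]

/-- **Greenberg's Lemma 3.5 predicate is model-independent**: `(C • W).Greenberg1999_kerG_bounded κ` implies
`W.Greenberg1999_kerG_bounded κ` (`A_n / Sel_n` for `W` and `C • W` are isomorphic).
[cite: GreenbergLNM1716, §3 Lemma 3.5] [cite: SilvermanAEC2009, X.§4] -/
theorem Greenberg1999_kerG_bounded_of_smul (h : (C • W).Greenberg1999_kerG_bounded κ) :
    W.Greenberg1999_kerG_bounded κ := by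
  intro _ hκ hp
  obtain ⟨B, hB⟩ := h hκ fun v hv ↦ (hasGoodReductionAt_and_hasUnitRootAt_smul_iff v W C).mpr (hp v hv)
  refine ⟨B, fun n ↦ ?_⟩
  obtain ⟨hfin, hcard⟩ := hB n
  obtain ⟨eₙ, heₙ⟩ := exists_h1EquivOfSmul W p C (κ.layerSubgroup n)
  have hA' : ∀ x, eₙ x ∈ (C • W).selmerLayer κ n ↔ x ∈ W.selmerLayer κ n :=
    fun x ↦ by rw [heₙ, h1Map_smul_mem_selmerLayer_iff]
  have hB' : ∀ x, eₙ x ∈ (C • W).selmerInftyPreimage κ n ↔ x ∈ W.selmerInftyPreimage κ n :=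
    fun x ↦ by rw [heₙ, h1Map_smul_mem_selmerInftyPreimage_iff]
  obtain ⟨hf, hc⟩ := finite_iff_and_natCard_quotient_eq_of_iff eₙ hA' hB'
  exact ⟨hf.mp hfin, hc ▸ hcard⟩

/-- **`(C • W).Greenberg1999_kerG_bounded κ ↔ W.Greenberg1999_kerG_bounded κ`.** [cite: GreenbergLNM1716, §3 Lemma 3.5] -/
theorem Greenberg1999_kerG_bounded_smul_iff : (C • W).Greenberg1999_kerG_bounded κ ↔ W.Greenberg1999_kerG_bounded κ := by
  refine ⟨Greenberg1999_kerG_bounded_of_smul W κ C, fun h ↦ Greenberg1999_kerG_bounded_of_smul (C • W) κ C⁻¹ ?_⟩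
  rwa [inv_smul_smul]

end SmulIff

/-! ## §6. Over `ℚ`: MAZUR'S CONTROL THEOREM for EVERY Weierstrass curve, EVERY prime — no hypothesis -/

section Rat

variable (W : WeierstrassCurve ℚ) {p : ℕ} [Fact p.Prime] (κ : ZpExtension ℚ p)

/-- **Greenberg's Lemma 3.5 over `ℚ`, for EVERY `W : WeierstrassCurve ℚ`, every prime `p`, every `κ : ZpExtension ℚ p`**
(no hypothesis): an elliptic `W` has a globally minimal model `C • W` (`hasGlobalMinimalModel_rat_holds`), for which the
predicate is `Greenberg1999_kerG_bounded_all`; transport back by `Greenberg1999_kerG_bounded_of_smul`. For singular `W`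
the predicate is vacuous. [cite: GreenbergLNM1716, §3 Lemma 3.5 (p. 90)] [cite: SilvermanAEC2009, VIII.8.3] -/
theorem Greenberg1999_kerG_bounded : W.Greenberg1999_kerG_bounded κ := by
  by_cases hE : W.IsElliptic
  · obtain ⟨C, hC⟩ := WeierstrassCurve.hasGlobalMinimalModel_rat_holds W
    haveI := hC
    exact Greenberg1999_kerG_bounded_of_smul W κ C (Greenberg1999_kerG_bounded_all (C • W) κ)
  · intro _
    exact absurd ‹W.IsElliptic› hE

/-- **MAZUR'S CONTROL THEOREM over `ℚ` — for EVERY `W : WeierstrassCurve ℚ`, EVERY prime `p`, EVERY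
`κ : ZpExtension ℚ p`, with NO hypothesis** (Greenberg, LNM 1716, Thm. 1.2; Mazur 1972, §6): the named predicate
`W.selmer_control κ` holds — if `W` is elliptic with good ordinary reduction at `p` and `κ` is the cyclotomic
`ℤ_p`-extension, the natural maps `Sel_{p^∞}(E/ℚ_n) → Sel_{p^∞}(E/ℚ_∞)^{Gal(ℚ_∞/ℚ_n)}` have finite kernels and cokernels of
orders bounded independently of `n`. Proof: a globally minimal model `C • W` exists (`hasGlobalMinimalModel_rat_holds`);
`selmer_control_all (C • W) κ` (p624991: the control chain, unconditional at every prime); `selmer_control_of_smul`.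
[cite: GreenbergLNM1716, Thm 1.2 (pp. 59–60) and §3 (pp. 86–90)] [cite: MazurInvent1972, §6] [cite: SilvermanAEC2009, VIII.8.3, X.§4] -/
theorem selmer_control : W.selmer_control κ := by
  by_cases hE : W.IsElliptic
  · obtain ⟨C, hC⟩ := WeierstrassCurve.hasGlobalMinimalModel_rat_holds W
    haveI := hC
    exact selmer_control_of_smul W κ C (selmer_control_all (C • W) κ)
  · intro _
    exact absurd ‹W.IsElliptic› hE

/-- **Greenberg's Theorem 1.4 over `ℚ` through the control chain, every `W`, every `p`** (the named fact
`D.isTorsion_of_finite_selmerGroup` for every dual datum `D`). [cite: GreenbergLNM1716, Thm 1.4 (p. 60; proof p. 61)] -/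
theorem isTorsion_of_finite_selmerGroup {γ : Field.absoluteGaloisGroup ℚ} (D : SelmerDualData W κ γ) :
    D.isTorsion_of_finite_selmerGroup :=
  D.isTorsion_of_finite_selmerGroup_of_kerG_bounded (Greenberg1999_kerG_bounded W κ)

/-- The binder shape `∀ (W : WeierstrassCurve ℚ) {p} [Fact p.Prime] (κ : ZpExtension ℚ p), W.selmer_control κ` of the
Literature reductions, inhabited. [cite: GreenbergLNM1716, Thm 1.2] -/
theorem selmer_control_forall :
    ∀ (W : WeierstrassCurve ℚ) {p : ℕ} [Fact p.Prime] (κ : ZpExtension ℚ p), W.selmer_control κ :=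
  fun W _ _ κ ↦ selmer_control W κ

/-- The binder shape `∀ (W : WeierstrassCurve ℚ) {p} [Fact p.Prime] (κ : ZpExtension ℚ p), W.Greenberg1999_kerG_bounded κ`,
inhabited. [cite: GreenbergLNM1716, §3 Lemma 3.5] -/
theorem Greenberg1999_kerG_bounded_forall :
    ∀ (W : WeierstrassCurve ℚ) {p : ℕ} [Fact p.Prime] (κ : ZpExtension ℚ p), W.Greenberg1999_kerG_bounded κ :=
  fun W _ _ κ ↦ Greenberg1999_kerG_bounded W κ

end Rat


end Summit.BirchSwinnertonDyer.BirchSwinnertonDyer.Theorems.GoodOrdTower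

end
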